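import Summits.HodgeConjecture.HodgeConjecture.Theorems.H413HoccOfRallis           -- ★ p811142 `HoccOfRallis.hocc_of_rankOneContCM (hR) : F0FloorSockets.HoccType` (P4 head re-homed, road β)
import Summits.HodgeConjecture.HodgeConjecture.Theorems.H413E2RallisRankOneOfKernel  -- ★ p810320 `E2RallisRankOne.rallisRankOneContCM_of_kernelCM` (E-2 parent, PORT-B)
import Summits.HodgeConjecture.HodgeConjecture.Theorems.H413E2SWSiegelWeilCMClosed   -- `E2SWSiegelWeilCM.siegelWeil_weilRange_CM` (Siegel–Weil in Weil's range, CM; F0P4-plan (g5) 06:40:34Z: NEW module, reserved FQ name) — over ★ `H413E2SWSiegelWeilCM` (`_of_fib`, imports ★ p810576 PORT-A) + `H413E2SWIdentityCloseFibreCMFinal.hfib_CM`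
import Summits.HodgeConjecture.HodgeConjecture.Theses.HCCMUnconditional              -- route file rev 1 (R2, commit 7a24856f3f6c): `def F0Hocc : Prop := …F0FloorSockets.HoccType` = item stmt-HodgeConjecture-27457
import HarnessLib

/-!
# FLOOR-0 support item `F0Hocc` (stmt-HodgeConjecture-27457) CLOSED — `F0Hocc_holds : Theses.HCCMUnconditional.F0Hocc`

Cell `hodgecm-mathlib`, programme HC_CM FLOOR 0 (D-0183), programme P4 (H413: admissible oscillator triples OCCUR in `H¹` at the printed datum).
HONEST LABEL: HC_CM is proved only modulo the 7 printed citations until rung 0 closes; THIS file discharges floor input III-2 (c)′ ONLY — the route's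
support decl `F0Hocc` (R2, director g14 s426: `def F0Hocc : Prop := Summit.HodgeConjecture.HodgeConjecture.Theorems.F0FloorSockets.HoccType`, the binder
`hocc` of ★ `hc_cm_of_generic_floor_v7`), i.e. [Liu2021, Prop. 4.13] «admissible ⇒ occurs in `H¹`» at the CM pin, now a THEOREM on Mathlib + the ★
Literature ∕ Theorems files (axioms = the Lean trio), by the road (β) chain of re-homed compositions (F0P4-plan (g4) 2026-08-31 ED. 4 recipe, A-plan1 (g19)):
P4 head ★ `HoccOfRallis.hocc_of_rankOneContCM` ∘ E-2 parent ★ `E2RallisRankOne.rallisRankOneContCM_of_kernelCM` ∘ E-2 child ★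
`E2SiegelWeil.kernelRallisIdentityCM_of_siegelWeil` ∘ the Siegel–Weil identity for the doubled pair `(U(J_V), U(J_W ⊕ᶠ −J_W))` in Weil's range over a
CM quadratic extension ★ `E2SWSiegelWeilCM.siegelWeil_weilRange_CM` [Weil1965, Thm. 5 (p. 76); Li1992, Thm 2.1].  Filed `--kind proof --workitem
stmt-HodgeConjecture-27457` by the named hand A-p17 (A-plan1 (g19) 2026-08-31T04:37Z).  No `def`, no `sorry`, no `Lines` import.

## References
[Liu2021] Prop. 4.13 and its proof (l. 2145) · [Li1992] Thm 2.1 (26) p. 184 · [Weil1965] Thm. 5 (p. 76).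
-/

set_option autoImplicit false
-- the mandated namespace has the single-problem summit's repeated segment (`HodgeConjecture.HodgeConjecture`)
set_option linter.dupNamespace false

namespace Summit.HodgeConjecture.HodgeConjecture.Theorems.HCCMUnconditionalF0HoccOfP4

open Summit.HodgeConjecture.HodgeConjecture.Cruxes.H413

/-- **`F0Hocc` HOLDS** — the FLOOR-0 socket III-2 (c)′ (admissible oscillator triples occur in `H¹` at the printed datum) is a THEOREM: the P4 head
modulo Rallis (★ `HoccOfRallis.hocc_of_rankOneContCM`) fed [Li1992, Thm 2.1] at rank one (★ E-2 parent port ∘ ★ E-2 child port ∘ ★ Siegel–Weil in Weil's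
range, CM).  HC_CM is proved only modulo the 7 printed citations until rung 0 closes. [cite: Liu2021, Prop. 4.13] [cite: Li1992, Thm 2.1 (26) p. 184]
[cite: Weil1965, Thm. 5 (p. 76)] -/
theorem F0Hocc_holds : Summit.HodgeConjecture.HodgeConjecture.Theses.HCCMUnconditional.F0Hocc :=
  HoccOfRallis.hocc_of_rankOneContCM
    (E2RallisRankOne.rallisRankOneContCM_of_kernelCM
      (E2SiegelWeil.kernelRallisIdentityCM_of_siegelWeil
        E2SWSiegelWeilCM.siegelWeil_weilRange_CM))

end Summit.HodgeConjecture.HodgeConjecture.Theorems.HCCMUnconditionalF0HoccOfP4
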